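import Literature.Barriers.ABC.BakerMethodBoundsWeakArchProofs
import Literature.Barriers.ABC.BakerMethodBoundsBakerWustholzProofs
import HarnessLib

/-!
# Proofs for `BakerMethodBounds`, IV: Baker–Wüstholz 1993 suffices at the infinite place

`Literature/Barriers/ABC/BakerMethodBoundsWeakArchBWProofs.lean` — fourth proofs companion of
the barrier file `Literature/Barriers/ABC/BakerMethodBounds.lean` (theorems only). File III
(`BakerMethodBoundsWeakArchProofs.lean`) proves `BakerMethodBounds` (Stewart–Yu 2001, Theorem 1
[cite: StewartYu2001, Theorem 1]) from a Yu-type `p`-adic clause plus a lower bound for linear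
forms in `2 ≤ n ≤ 4` logarithms of positive rationals with ARBITRARY constants. This file feeds
that archimedean hypothesis from the named fact
`Literature.NumberTheory.DiophantineGeometry.baker_wustholz ℚ` (Baker–Wüstholz 1993 =
[BakerWustholz2007, Thm 7.1], the archimedean estimate Baker–Wüstholz name as Stewart–Yu's
input [cite: BakerWustholz2007, §3.7 p. 69]) through its rational specialisation
`bakerWustholz_rat_of_pos` (`BakerMethodBoundsBakerWustholzProofs.lean`):

* `archBound_of_bakerWustholz` — the archimedean hypothesis of file III with
  `C(n) = C(n,1) (25/4)^n`, `C(n,1) = bwConstant n 1 = 18 (n+1)! n^{n+1} 32^{n+2} log(2n)`;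
* `BakerMethodBounds_of_thm328Finite_bakerWustholz`, `BakerMethodBounds_of_yu_bakerWustholz`,
  `BakerMethodBounds_of_padicBound_bakerWustholz`, `stewart_yu_of_yu_bakerWustholz` — the
  barrier declaration from `baker_wustholz ℚ` and, at the finite places, Evertse–Győry's
  Theorem 3.2.8 over `ℚ` / Yu's Theorem 3.2.7 over `ℚ` as printed / any `p`-adic bound of Yu's
  shape (the binders of `Dioph.thm328_rat_finite_of_yu`, `Dioph.thm328_rat_finite_of_padicBound`).

So the undischarged inputs of `BakerMethodBounds` along this line are: the named fact
`baker_wustholz ℚ` (whose full proof is Chapter 7 of the held book [BakerWustholz2007]) and a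
`p`-adic bound of Yu's shape over `ℚ` (Yu 2007; no Lean formalisation exists).

## References

* [StewartYu2001] C. L. Stewart, K. Yu, *On the abc conjecture, II*, Duke Math. J. 108 (2001),
  169–181 — Theorem 1.
* [BakerWustholz2007] A. Baker, G. Wüstholz, *Logarithmic Forms and Diophantine Geometry*,
  CUP 2007 — §3.7 (p. 69), Thm 7.1 (p. 125).
* [BakerWustholz1993] A. Baker, G. Wüstholz, *Logarithmic forms and group varieties*, J. reine
  angew. Math. 442 (1993), 19–62 — Theorem.
* [EvertseGyory2015] J.-H. Evertse, K. Győry, *Unit Equations in Diophantine Number Theory*,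
  CUP 2015 — Thm 3.2.7, Thm 3.2.8 (p. 62).
-/

noncomputable section

open Finset Real Height
open Literature.NumberTheory.DiophantineGeometry
open Literature.NumberTheory.DiophantineGeometry.Dioph

namespace Literature.Barriers.ABC

/-- `C(n, 1) ≥ 0` for `n ≥ 1` (Baker–Wüstholz constant). [folklore] -/
theorem bwConstant_one_nonneg {n : ℕ} (hn : 1 ≤ n) : 0 ≤ bwConstant n 1 := by
  unfold bwConstant
  have hlog : 0 ≤ Real.log (2 * (n : ℝ) * ((1 : ℕ) : ℝ)) := by
    apply Real.log_nonneg
    have : (1 : ℝ) ≤ n := by exact_mod_cast hn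
    push_cast; linarith
  positivity

/-- **The archimedean hypothesis of `BakerMethodBoundsWeakArchProofs` from Baker–Wüstholz 1993
over `ℚ`.** From the named fact `baker_wustholz ℚ` ([BakerWustholz2007, Thm 7.1] for `K = ℚ`):
for `2 ≤ n ≤ 4` positive rationals `αₖ ≠ 1`, integers `bₖ` with `Λ = ∑ bₖ log αₖ ≠ 0`,
`Aₖ ≥ max{h(αₖ), |log αₖ|, 0.16}` and `B ≥ max{1, |bₖ|}`:
`log |Λ| > −C(n,1) (25/4)^n · A₁⋯Aₙ · log(eB)` (`max{h(αₖ), 1} ≤ (25/4) Aₖ` as `Aₖ ≥ 0.16`).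
[cite: BakerWustholz2007, Thm 7.1 (p. 125)] -/
theorem archBound_of_bakerWustholz (hBW : baker_wustholz ℚ) :
    ∀ (κ : Type) [Fintype κ], 2 ≤ Fintype.card κ → Fintype.card κ ≤ 4 →
      ∀ (α : κ → ℚ) (b : κ → ℤ) (A : κ → ℝ) (B : ℝ),
        (∀ k, 0 < α k ∧ α k ≠ 1) → b ≠ 0 →
        ∑ k, (b k : ℝ) * Real.log (α k : ℝ) ≠ 0 →
        (∀ k, max (logHeight₁ (α k)) (max |Real.log (α k : ℝ)| 0.16) ≤ A k) →
        1 ≤ B → (∀ k, (|b k| : ℝ) ≤ B) →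
        -((bwConstant (Fintype.card κ) 1 * (25 / 4) ^ Fintype.card κ) * (∏ k, A k) *
            Real.log (Real.exp 1 * B)) <
          Real.log |∑ k, (b k : ℝ) * Real.log (α k : ℝ)| := by
  intro κ _ h2 _ α b A B hα _ hS hAk hB1 hbB
  classical
  set n := Fintype.card κ with hn
  set x : ℚ := ∏ k, α k ^ b k with hx
  have hlogx : Real.log (x : ℝ) = ∑ k, (b k : ℝ) * Real.log (α k : ℝ) := by
    rw [hx]; push_cast
    rw [Real.log_prod fun k _ => (zpow_pos (by exact_mod_cast (hα k).1) _).ne']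
    exact Finset.sum_congr rfl fun k _ => Real.log_zpow _ _
  have hx1 : x ≠ 1 := by
    intro h1
    apply hS
    rw [← hlogx, h1]; simp
  have key := bakerWustholz_rat_of_pos hBW α b (fun k => (hα k).1) rfl hx1
  rw [hlogx] at key
  -- comparison of the two constants
  have hbwC : 0 ≤ bwConstant n 1 := bwConstant_one_nonneg (by omega)
  have hApos : ∀ k, 0.16 ≤ A k := fun k => (le_max_right _ _).trans ((le_max_right _ _).trans (hAk k))
  have hprod : ∏ k, max (logHeight₁ (α k)) 1 ≤ (25 / 4) ^ n * ∏ k, A k := by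
    rw [hn, ← Finset.card_univ, ← Finset.prod_const, ← Finset.prod_mul_distrib]
    refine Finset.prod_le_prod (fun k _ => zero_le_one.trans (le_max_right _ _)) fun k _ => ?_
    have h1 := hApos k
    refine max_le ?_ (by linarith)
    exact ((le_max_left _ _).trans (hAk k)).trans (by linarith)
  have hprod0 : 0 ≤ ∏ k, max (logHeight₁ (α k)) 1 :=
    Finset.prod_nonneg fun k _ => zero_le_one.trans (le_max_right _ _)
  set B₀ : ℕ := Finset.univ.sup fun k => (b k).natAbs with hB₀
  have hB₀le : (B₀ : ℝ) ≤ B := by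
    have hne : (Finset.univ : Finset κ).Nonempty := by
      rw [Finset.univ_nonempty_iff, ← Fintype.card_pos_iff]; omega
    obtain ⟨k, -, hk⟩ := Finset.exists_mem_eq_sup Finset.univ hne fun k => (b k).natAbs
    rw [hB₀, hk, Nat.cast_natAbs, Int.cast_abs]
    exact hbB k
  have heB : 1 ≤ Real.exp 1 * B := one_le_mul_of_one_le_of_one_le
    (by linarith [Real.add_one_le_exp (1 : ℝ)]) hB1
  have hlogB : Real.log (Real.exp 1 * B₀) ≤ Real.log (Real.exp 1 * B) := by
    rcases Nat.eq_zero_or_pos B₀ with h0 | hpos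
    · rw [h0, Nat.cast_zero, mul_zero, Real.log_zero]
      exact Real.log_nonneg heB
    · exact Real.log_le_log (by positivity) (mul_le_mul_of_nonneg_left hB₀le (Real.exp_pos 1).le)
  have hlogB0 : 0 ≤ Real.log (Real.exp 1 * B₀) := by
    rcases Nat.eq_zero_or_pos B₀ with h0 | hpos
    · rw [h0, Nat.cast_zero, mul_zero, Real.log_zero]
    · apply Real.log_nonneg
      exact one_le_mul_of_one_le_of_one_le (by linarith [Real.add_one_le_exp (1 : ℝ)])
        (by exact_mod_cast hpos)
  have hcmp : bwConstant n 1 * (∏ k, max (logHeight₁ (α k)) 1) * Real.log (Real.exp 1 * B₀) ≤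
      bwConstant n 1 * (25 / 4) ^ n * (∏ k, A k) * Real.log (Real.exp 1 * B) := by
    calc bwConstant n 1 * (∏ k, max (logHeight₁ (α k)) 1) * Real.log (Real.exp 1 * B₀)
        ≤ bwConstant n 1 * ((25 / 4) ^ n * ∏ k, A k) * Real.log (Real.exp 1 * B) :=
          mul_le_mul (mul_le_mul_of_nonneg_left hprod hbwC) hlogB hlogB0
            (mul_nonneg hbwC (hprod0.trans hprod))
      _ = _ := by ring
  linarith


/-- `C(n,1) (25/4)^n ≥ 0` for `n ≥ 2`. [folklore] -/
theorem bwArchConstant_nonneg (n : ℕ) (hn : 2 ≤ n) : 0 ≤ bwConstant n 1 * (25 / 4) ^ n :=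
  mul_nonneg (bwConstant_one_nonneg (by omega)) (by positivity)

/-- **`BakerMethodBounds` from Baker–Wüstholz 1993 over `ℚ` at the infinite place and
Evertse–Győry's Theorem 3.2.8 over `ℚ` at the finite places** (`h328` as in
`BakerMethodBounds_of_thm328Finite_archBound`).
[cite: StewartYu2001, Theorem 1] [cite: BakerWustholz2007, Thm 7.1] [cite: EvertseGyory2015, Thm 3.2.8 (p. 62)] -/
theorem BakerMethodBounds_of_thm328Finite_bakerWustholz
    (h328 : ∀ (ι : Type) [Fintype ι], 0 < Fintype.card ι →
      ∀ α : ι → ℚ, (∀ i, α i ≠ 0 ∧ α i ≠ 1 ∧ α i ≠ -1) →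
      ∀ β : ℚ, β ≠ 0 → ∀ s : ℤ, (s = 1 ∨ s = -1) → ∀ b : ι → ℤ,
        (∏ i, α i ^ b i) * β ^ s - 1 ≠ 0 →
      ∀ B : ℝ, (∀ i, (|b i| : ℝ) ≤ B) →
        2 * Real.exp 1 * 9 ^ (Fintype.card ι + 1) * (∏ i, logHeight₁ (α i)) *
            max (logHeight₁ β) 1 ≤ B →
        ∀ p : ℕ, p.Prime →
          -(egC6 (Fintype.card ι + 1) * (p / Real.log p) * (∏ i, logHeight₁ (α i)) *
              max (logHeight₁ β) 1 * logStar (B * p / max (logHeight₁ β) 1)) <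
            -(padicValRat p ((∏ i, α i ^ b i) * β ^ s - 1) : ℝ) * Real.log p)
    (hBW : baker_wustholz ℚ) : BakerMethodBounds :=
  BakerMethodBounds_of_thm328Finite_archBound h328 (fun n => bwConstant n 1 * (25 / 4) ^ n)
    bwArchConstant_nonneg (archBound_of_bakerWustholz hBW)

/-- **`BakerMethodBounds` from Yu 2007 over `ℚ` (as printed, Evertse–Győry's Theorem 3.2.7) and
Baker–Wüstholz 1993 over `ℚ`** — the two inputs Baker–Wüstholz name for Stewart–Yu's theorem
("based on the archimedean estimate … Theorem 7.1 and the non-archimedean analogues of Kunrui Yu"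
[cite: BakerWustholz2007, §3.7 p. 69]); `hY` is verbatim the hypothesis of
`Dioph.thm328_rat_finite_of_yu`.
[cite: StewartYu2001, Theorem 1] [cite: BakerWustholz2007, Thm 7.1] [cite: EvertseGyory2015, Thm 3.2.7 (p. 62)] -/
theorem BakerMethodBounds_of_yu_bakerWustholz
    (hY : ∀ (κ : Type) [Fintype κ] [DecidableEq κ], 2 ≤ Fintype.card κ →
      ∀ (α : κ → ℚ) (b : κ → ℤ) (k₀ : κ) (B Bn δ : ℝ) (p : ℕ), p.Prime →
        (∀ k, α k ≠ 0) → b k₀ ≠ 0 →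
        (∀ k, b k ≠ 0 → padicValInt p (b k₀) ≤ padicValInt p (b k)) →
        (∀ k, (|b k| : ℝ) ≤ B) → Bn ≤ B → (|b k₀| : ℝ) ≤ Bn →
        ∏ k, α k ^ b k - 1 ≠ 0 → 0 < δ → δ ≤ 1 / 2 →
        (padicValRat p (∏ k, α k ^ b k - 1) : ℝ) <
          (16 * Real.exp 1) ^ (2 * (Fintype.card κ + 1)) * (Fintype.card κ : ℝ) ^ (3 / 2 : ℝ) *
              Real.log (2 * Fintype.card κ) * Real.log 2 *
            (p / Real.log p ^ 2) *
            max ((∏ k, max (logHeight₁ (α k)) (1 / (16 * Real.exp 1 ^ 2))) *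
                  Real.log (Bn * (2 * Real.exp 1 ^ ((Fintype.card κ + 1) *
                      (6 * Fintype.card κ + 5)) * Real.log 2) * (p : ℝ) ^ (Fintype.card κ + 1) *
                    (∏ k ∈ univ.erase k₀, max (logHeight₁ (α k)) (1 / (16 * Real.exp 1 ^ 2))) /
                    δ))
              (δ * B / (Bn * (2 ^ (2 * Fintype.card κ + 1) * Real.log 2 * Real.log 3 ^ 3))))
    (hBW : baker_wustholz ℚ) : BakerMethodBounds :=
  BakerMethodBounds_of_thm328Finite_bakerWustholz (thm328_rat_finite_of_yu hY) hBW

/-- **`BakerMethodBounds` from any `p`-adic bound of Yu's shape over `ℚ` (generic constant `C₃(n)`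
with `C₃(n) · 7(n+1)² ≤ C₆(n,1)`, the binder of `Dioph.thm328_rat_finite_of_padicBound`) and
Baker–Wüstholz 1993 over `ℚ`.**
[cite: StewartYu2001, Theorem 1] [cite: BakerWustholz2007, Thm 7.1] [cite: EvertseGyory2015, Thm 3.2.7 (p. 62)] -/
theorem BakerMethodBounds_of_padicBound_bakerWustholz (C₃ : ℕ → ℝ)
    (hC₃0 : ∀ n, 2 ≤ n → 0 ≤ C₃ n)
    (hC₃le : ∀ n, 2 ≤ n → C₃ n * (7 * ((n : ℝ) + 1) ^ 2) ≤ egC6 n)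
    (hY : ∀ (κ : Type) [Fintype κ] [DecidableEq κ], 2 ≤ Fintype.card κ →
      ∀ (α : κ → ℚ) (b : κ → ℤ) (k₀ : κ) (B Bn δ : ℝ) (p : ℕ), p.Prime →
        (∀ k, α k ≠ 0) → b k₀ ≠ 0 →
        (∀ k, b k ≠ 0 → padicValInt p (b k₀) ≤ padicValInt p (b k)) →
        (∀ k, (|b k| : ℝ) ≤ B) → Bn ≤ B → (|b k₀| : ℝ) ≤ Bn →
        ∏ k, α k ^ b k - 1 ≠ 0 → 0 < δ → δ ≤ 1 / 2 →
        (padicValRat p (∏ k, α k ^ b k - 1) : ℝ) <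
          C₃ (Fintype.card κ) * (p / Real.log p ^ 2) *
            max ((∏ k, max (logHeight₁ (α k)) (1 / (16 * Real.exp 1 ^ 2))) *
                  Real.log (Bn * (2 * Real.exp 1 ^ ((Fintype.card κ + 1) *
                      (6 * Fintype.card κ + 5)) * Real.log 2) * (p : ℝ) ^ (Fintype.card κ + 1) *
                    (∏ k ∈ univ.erase k₀, max (logHeight₁ (α k)) (1 / (16 * Real.exp 1 ^ 2))) /
                    δ))
              (δ * B / (Bn * (2 ^ (2 * Fintype.card κ + 1) * Real.log 2 * Real.log 3 ^ 3))))
    (hBW : baker_wustholz ℚ) : BakerMethodBounds :=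
  BakerMethodBounds_of_thm328Finite_bakerWustholz
    (thm328_rat_finite_of_padicBound C₃ hC₃0 hC₃le hY) hBW

/-- **Stewart–Yu 2001, Theorem 1 (`abc.S06`, `Literature.NumberTheory.DiophantineGeometry.stewart_yu`)
from Yu 2007 over `ℚ` and Baker–Wüstholz 1993 over `ℚ`.**
[cite: StewartYu2001, Theorem 1] [cite: BakerWustholz2007, §3.7 p. 69, Thm 7.1] -/
theorem stewart_yu_of_yu_bakerWustholz
    (hY : ∀ (κ : Type) [Fintype κ] [DecidableEq κ], 2 ≤ Fintype.card κ →
      ∀ (α : κ → ℚ) (b : κ → ℤ) (k₀ : κ) (B Bn δ : ℝ) (p : ℕ), p.Prime →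
        (∀ k, α k ≠ 0) → b k₀ ≠ 0 →
        (∀ k, b k ≠ 0 → padicValInt p (b k₀) ≤ padicValInt p (b k)) →
        (∀ k, (|b k| : ℝ) ≤ B) → Bn ≤ B → (|b k₀| : ℝ) ≤ Bn →
        ∏ k, α k ^ b k - 1 ≠ 0 → 0 < δ → δ ≤ 1 / 2 →
        (padicValRat p (∏ k, α k ^ b k - 1) : ℝ) <
          (16 * Real.exp 1) ^ (2 * (Fintype.card κ + 1)) * (Fintype.card κ : ℝ) ^ (3 / 2 : ℝ) *
              Real.log (2 * Fintype.card κ) * Real.log 2 *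
            (p / Real.log p ^ 2) *
            max ((∏ k, max (logHeight₁ (α k)) (1 / (16 * Real.exp 1 ^ 2))) *
                  Real.log (Bn * (2 * Real.exp 1 ^ ((Fintype.card κ + 1) *
                      (6 * Fintype.card κ + 5)) * Real.log 2) * (p : ℝ) ^ (Fintype.card κ + 1) *
                    (∏ k ∈ univ.erase k₀, max (logHeight₁ (α k)) (1 / (16 * Real.exp 1 ^ 2))) /
                    δ))
              (δ * B / (Bn * (2 ^ (2 * Fintype.card κ + 1) * Real.log 2 * Real.log 3 ^ 3))))
    (hBW : baker_wustholz ℚ) : Literature.NumberTheory.DiophantineGeometry.stewart_yu :=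
  BakerMethodBounds_of_yu_bakerWustholz hY hBW

end Literature.Barriers.ABC

end
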